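import Literature.AlgebraicGeometry.ModuliOfAbelianVarieties.SiegelFineModuliScheme
import Literature.AlgebraicGeometry.AbelianSchemes.PolarizedAbelianSchemeWithLevelBaseChange
import Literature.AlgebraicGeometry.Motives.BaseChangePointsOfTower
import Literature.AlgebraicGeometry.Motives.RestrictScalarsPoints
import HarnessLib

/-!
# The classifying map of a family over a complex piece, read on complex points
# ([MumfordFogartyKirwan1994] Ch. 7 §2–§3; [GortzWedhorn2020] (4.7); [Milne2005ShimuraVarieties] §6 Thm. 6.11)

Topic `AlgebraicGeometry/ModuliOfAbelianVarieties`; namespace `Literature.AlgebraicGeometry.ModuliOfAbelianVarieties`.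
KERNEL ONLY: theorems; no definition, no named fact, no instance, no `sorry`.

Cell hodgecm-mathlib (D-0151), Hecke-link line (`B-plan/F-census/HECKE-LINK-line.v1.2`), socket (B) «the isogeny-quotient
map», node H4-ALG (B-plan1 (g14) 2026-08-29T21:01:08Z; consumer = the H4 assembler over ★
`SiegelHeckeQuotientPeriodCompatible` / its section-kernel edition).  The socket asks for a CONTINUOUS map
`Φ : S″(ℂ) → 𝓜_ℂ(ℂ)` on a complex piece `S″` together with, at every complex point `s`, a «pointwise Hecke quotient» of
class `Φ s`.  Continuity can only come from an ALGEBRAIC classifying map: for a triple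
`Q : PolarizedAbelianSchemeWithLevel g N δ S″.left` (the quotient family, OPAQUE here) one takes the `ℚ`-morphism
`q := 𝓜.classifyingMap (S″.restrictScalars ℚ) Q` ([MumfordFogartyKirwan1994] Thm. 7.9, ★ `SiegelFineModuliScheme.classify`)
and its `ℂ`-form `qℂ : S″ ⟶ 𝓜 ⊗ ℂ` ([GortzWedhorn2020] (4.7): `Hom_ℚ(S″, 𝓜) = Hom_ℂ(S″, 𝓜 ⊗ ℂ)`), so that
`Φ := AlgPoints.map qℂ` is continuous by ★ `AlgPoints.continuous_map`.  With NO new definition (the `ℂ`-form is consumed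
in RELATION form `qℂ.left ≫ π = q.left`, `π : 𝓜 ⊗ ℂ → 𝓜` the projection ★ `baseChangeHomFst`):

* §1a `existsUnique_hom_baseChange_left_comp_fst` / `hom_baseChange_ext` / `existsUnique_restrictScalars_hom_left_eq` —
  the adjunction `Over.map ⊣ Over.pullback` for a complex piece, both directions, relation form (★
  `Motives/BaseChangePointsOfTower` is the case of `Spec`-sources);
* §1b `classifyingMap_baseChange_eq_comp` (the fibre of `Q` along `x : T → S″` has class `x ≫ q`, ★ `classifyingMap_comp`),
  **`baseChangeEquiv_classifyingMap_baseChange`** (the complex point of `𝓜 ⊗ ℂ` classifying the triple `Q ×_{S″} s`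
  over `Spec ℂ` IS `Φ s = AlgPoints.map qℂ s` — the class conjunct of the pointwise Hecke quotient), and the SOURCE
  companions `classifyingMap_univ_baseChange_restrictScalars` / `baseChangeEquiv_classifyingMap_univ_baseChange_baseChange`
  (the universal family pulled back along `ι : S″ → 𝓜 ⊗ ℂ` has fibres of class `ι s`).

The fibrewise inputs (dim)/(S)/(dominant)/(K-alg) of the pointwise theorem for an `S″`-homomorphism `ψ : P′.A → Q.A` are
the companion file `AbelianSchemes/AbelianSchemeFibreHomBaseChangeId`; (L) is ★-to-be `SectionBaseChangeAlongHom`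
(B-p17 (g10)).  Presearch: [MumfordFogartyKirwan1994] Ch. 7 §2 Def. 7.2–7.3 / §3 Thm. 7.9 (held, chunks p0134–p0144),
[GortzWedhorn2020] (4.7) (held); tree: ★ `classifyingMap_comp`, ★ `BaseChangePointsOfTower`, ★
`UHeadGlueClassMap.classifyingMap_univ_baseChange` (the point case).  HC_CM is proved only modulo the 7 printed citations
until rung 0 closes; this file discharges none of them.

## References
* [MumfordFogartyKirwan1994] D. Mumford, J. Fogarty, F. Kirwan, *Geometric Invariant Theory*, 3rd ed. (1994), Ch. 7 §2
  Def. 7.2–7.3 (p. 129), §3 Thm. 7.9 (p. 139).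
* [GortzWedhorn2020] U. Görtz, T. Wedhorn, *Algebraic Geometry I*, 2nd ed. (2020), Section (4.7) (pp. 107–108).
* [Milne2005ShimuraVarieties] J. S. Milne, *Introduction to Shimura varieties* (2005), §6 Thm. 6.11 (pp. 74–75).
* [Hartshorne1977] R. Hartshorne, *Algebraic Geometry* (1977), II §3 Thm. 3.3.
-/

set_option autoImplicit false

noncomputable section

open CategoryTheory CategoryTheory.Limits AlgebraicGeometry
open Literature.AlgebraicGeometry.Motives (SchemeOver ComplexPoints AlgPoints specOver baseChangeHom baseChangeHomFst)
open Literature.AlgebraicGeometry.AbelianSchemes (PolarizedAbelianSchemeWithLevel AbelianSchemeOver)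

namespace Literature.AlgebraicGeometry.ModuliOfAbelianVarieties

/-! ### §1a The `ℂ`-form of a `ℚ`-morphism out of a complex piece (Mathlib `Over.mapPullbackAdj`, relation form) -/

section Lift

variable {S'' : SchemeOver ℂ} {X : SchemeOver ℚ}

/-- **The `ℂ`-form of a `ℚ`-morphism out of a complex piece**: for a `ℂ`-scheme `S″` and a `ℚ`-scheme `X`, every
`ℚ`-morphism `f : S″ → X` (source read over `ℚ`) is `t ≫ π` for a unique `ℂ`-morphism `t : S″ → X ⊗ ℂ`
(`π : X ⊗ ℂ → X` the projection) — the adjunction `Over.map ⊣ Over.pullback` / universal property of the fibre product,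
in relation form `t.left ≫ π = f.left`. [cite: GortzWedhorn2020, Section (4.7) (pp. 107–108)] [cite: Hartshorne1977, II §3 Theorem 3.3] -/
theorem existsUnique_hom_baseChange_left_comp_fst (f : S''.restrictScalars ℚ ⟶ X) :
    ∃! t : S'' ⟶ (Literature.AlgebraicGeometry.Motives.baseChange ℚ ℂ).obj X,
      t.left ≫ baseChangeHomFst (algebraMap ℚ ℂ) X = f.left := by
  have hw : f.left ≫ X.hom = S''.hom ≫ Spec.map (CommRingCat.ofHom (algebraMap ℚ ℂ)) := Over.w f
  refine ⟨Over.homMk (pullback.lift f.left S''.hom hw) (pullback.lift_snd _ _ _), pullback.lift_fst _ _ _, ?_⟩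
  intro t ht
  ext
  change t.left = pullback.lift f.left S''.hom hw
  apply pullback.hom_ext
  · exact ht.trans (pullback.lift_fst _ _ _).symm
  · exact (Over.w t).trans (pullback.lift_snd _ _ _).symm

/-- Two `ℂ`-morphisms `S″ → X ⊗ ℂ` with the same composite to `X` are equal (uniqueness half, `pullback.hom_ext`).
[cite: GortzWedhorn2020, Section (4.7) (pp. 107–108)] -/
theorem hom_baseChange_ext {t₁ t₂ : S'' ⟶ (Literature.AlgebraicGeometry.Motives.baseChange ℚ ℂ).obj X}
    (h : t₁.left ≫ baseChangeHomFst (algebraMap ℚ ℂ) X = t₂.left ≫ baseChangeHomFst (algebraMap ℚ ℂ) X) :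
    t₁ = t₂ := by
  ext
  apply pullback.hom_ext
  · exact h
  · exact (Over.w t₁).trans (Over.w t₂).symm

/-- **The `ℚ`-form of a `ℂ`-morphism into a base change**: every `ℂ`-morphism `t : S″ → X ⊗ ℂ` lies over a unique
`ℚ`-morphism `f : S″ → X` (namely `t ≫ π`), in relation form `t.left ≫ π = f.left`.
[cite: GortzWedhorn2020, Section (4.7) (pp. 107–108)] [cite: Hartshorne1977, II §3 Theorem 3.3] -/
theorem existsUnique_restrictScalars_hom_left_eq
    (t : S'' ⟶ (Literature.AlgebraicGeometry.Motives.baseChange ℚ ℂ).obj X) :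
    ∃! f : S''.restrictScalars ℚ ⟶ X, t.left ≫ baseChangeHomFst (algebraMap ℚ ℂ) X = f.left := by
  have hc : baseChangeHomFst (algebraMap ℚ ℂ) X ≫ X.hom =
      ((Literature.AlgebraicGeometry.Motives.baseChange ℚ ℂ).obj X).hom ≫ Spec.map (CommRingCat.ofHom (algebraMap ℚ ℂ)) :=
    pullback.condition
  have hw : (t.left ≫ baseChangeHomFst (algebraMap ℚ ℂ) X) ≫ X.hom = (S''.restrictScalars ℚ).hom :=
    (Category.assoc _ _ _).trans (((congrArg (t.left ≫ ·) hc).trans (Category.assoc _ _ _).symm).trans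
      (congrArg (· ≫ Spec.map (CommRingCat.ofHom (algebraMap ℚ ℂ))) (Over.w t)))
  exact ⟨Over.homMk (t.left ≫ baseChangeHomFst (algebraMap ℚ ℂ) X) hw, rfl, fun f hf => Over.OverMorphism.ext hf.symm⟩

end Lift

/-! ### §1b The classifying map of a family over a complex piece at a complex point -/

section ClassMap

variable {g N : ℕ} {δ : Fin g → ℕ} (𝓜 : SiegelFineModuliScheme g N δ)
  {S'' : SchemeOver ℂ} [IsLocallyNoetherian S''.left]

/-- **The fibre of a family along `x : T → S″` has classifying map `x ≫ q`** (`q` the classifying map of the family over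
the piece read over `ℚ`; ★ `classifyingMap_comp` with the pull-back witness ★ `baseChange_isBaseChangeVia`) — the
naturality of Mumford's representing object. [cite: MumfordFogartyKirwan1994, Ch. 7 §2 Definitions 7.2–7.3 (p. 129) and §3 Theorem 7.9 (p. 139)] -/
theorem classifyingMap_baseChange_eq_comp {T : SchemeOver ℚ} [IsLocallyNoetherian T.left]
    (Q : PolarizedAbelianSchemeWithLevel g N δ S''.left) (x : T ⟶ S''.restrictScalars ℚ) :
    𝓜.classifyingMap T (Q.baseChange x.left) =
      x ≫ (haveI : IsLocallyNoetherian (S''.restrictScalars ℚ).left := ‹IsLocallyNoetherian S''.left›;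
        𝓜.classifyingMap (S''.restrictScalars ℚ) Q) := by
  haveI : IsLocallyNoetherian (S''.restrictScalars ℚ).left := ‹IsLocallyNoetherian S''.left›
  exact (𝓜.classifyingMap_comp x Q (Q.baseChange x.left) (Q.baseChange_isBaseChangeVia x.left)).symm

/-- **The complex point classifying the fibre `Q_s` is `Φ s = s ≫ qℂ`**: for a family `Q` over a complex piece `S″` with
classifying map `q` (over `ℚ`) of `ℂ`-form `qℂ` (`qℂ.left ≫ π = q.left`), the `ℂ`-point of `𝓜 ⊗ ℂ` corresponding
(★ `AlgPoints.baseChangeEquiv`) to the classifying map of the triple `Q ×_{S″} s` over `Spec ℂ` is `AlgPoints.map qℂ s`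
— the class conjunct of the pointwise Hecke quotient in ★ `hcompat_of_pointwiseHeckeQuotient`, with
`Φ := AlgPoints.map qℂ` continuous by ★ `AlgPoints.continuous_map`.
[cite: MumfordFogartyKirwan1994, Ch. 7 §3 Theorem 7.9 (p. 139)] [cite: GortzWedhorn2020, Section (4.7) (pp. 107–108)]
[cite: Milne2005ShimuraVarieties, §6 Thm. 6.11 pp. 74–75] -/
theorem baseChangeEquiv_classifyingMap_baseChange [IsLocallyNoetherian (specOver ℚ ℂ).left]
    (Q : PolarizedAbelianSchemeWithLevel g N δ S''.left)
    (qℂ : S'' ⟶ (Literature.AlgebraicGeometry.Motives.baseChange ℚ ℂ).obj 𝓜.M)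
    (hq : qℂ.left ≫ baseChangeHomFst (algebraMap ℚ ℂ) 𝓜.M =
      (haveI : IsLocallyNoetherian (S''.restrictScalars ℚ).left := ‹IsLocallyNoetherian S''.left›;
        𝓜.classifyingMap (S''.restrictScalars ℚ) Q).left)
    (s : ComplexPoints S'') :
    AlgPoints.baseChangeEquiv (algebraMap ℚ ℂ) 𝓜.M (𝓜.classifyingMap (specOver ℚ ℂ) (Q.baseChange s.left)) =
      AlgPoints.map qℂ s := by
  haveI : IsLocallyNoetherian (S''.restrictScalars ℚ).left := ‹IsLocallyNoetherian S''.left›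
  -- the `ℚ`-form of the complex point `s`
  let sℚ : specOver ℚ ℂ ⟶ S''.restrictScalars ℚ :=
    (AlgPoints.specOverIsoMapObj (algebraMap ℚ ℂ)).hom ≫
      (Over.map (Spec.map (CommRingCat.ofHom (algebraMap ℚ ℂ)))).map s
  have hsℚ : sℚ.left = s.left := by
    change (𝟙 _) ≫ s.left = s.left
    exact Category.id_comp _
  symm
  rw [Literature.AlgebraicGeometry.Motives.eq_baseChangeEquiv_iff_left_comp_fst]
  have h1 : 𝓜.classifyingMap (specOver ℚ ℂ) (Q.baseChange s.left) = sℚ ≫ 𝓜.classifyingMap (S''.restrictScalars ℚ) Q := by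
    have h := classifyingMap_baseChange_eq_comp 𝓜 Q sℚ
    rw [hsℚ] at h
    exact h
  rw [h1, Over.comp_left, hsℚ, ← hq]
  rfl

/-- **The universal family pulled back along `ιℚ : S″ → 𝓜` has classifying map `ιℚ`** (uniqueness in ★ `classify`
with the witness ★ `baseChange_isBaseChangeVia`). [cite: MumfordFogartyKirwan1994, Ch. 7 §3 Theorem 7.9 (p. 139)] -/
theorem classifyingMap_univ_baseChange_restrictScalars (ιℚ : S''.restrictScalars ℚ ⟶ 𝓜.M) :
    (haveI : IsLocallyNoetherian (S''.restrictScalars ℚ).left := ‹IsLocallyNoetherian S''.left›;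
      𝓜.classifyingMap (S''.restrictScalars ℚ) (𝓜.univ.baseChange ιℚ.left)) = ιℚ := by
  haveI : IsLocallyNoetherian (S''.restrictScalars ℚ).left := ‹IsLocallyNoetherian S''.left›
  exact (𝓜.eq_classifyingMap _ _ ιℚ ⟨_, _, 𝓜.univ.baseChange_isBaseChangeVia ιℚ.left⟩).symm

/-- **The fibre at `s` of the universal family pulled back along `ι : S″ → 𝓜 ⊗ ℂ` has class `ι s`** (the SOURCE
companion of `baseChangeEquiv_classifyingMap_baseChange`: the `U′`-clause of the section-kernel edition of ★
`hcompat_of_pointwiseHeckeQuotient`). [cite: MumfordFogartyKirwan1994, Ch. 7 §3 Theorem 7.9 (p. 139)]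
[cite: GortzWedhorn2020, Section (4.7) (pp. 107–108)] -/
theorem baseChangeEquiv_classifyingMap_univ_baseChange_baseChange [IsLocallyNoetherian (specOver ℚ ℂ).left]
    (ι : S'' ⟶ (Literature.AlgebraicGeometry.Motives.baseChange ℚ ℂ).obj 𝓜.M) (ιℚ : S''.restrictScalars ℚ ⟶ 𝓜.M)
    (hι : ι.left ≫ baseChangeHomFst (algebraMap ℚ ℂ) 𝓜.M = ιℚ.left) (s : ComplexPoints S'') :
    AlgPoints.baseChangeEquiv (algebraMap ℚ ℂ) 𝓜.M
        (𝓜.classifyingMap (specOver ℚ ℂ) ((𝓜.univ.baseChange ιℚ.left).baseChange s.left)) = AlgPoints.map ι s :=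
  baseChangeEquiv_classifyingMap_baseChange 𝓜 _ ι
    (hι.trans (congrArg Over.Hom.left (classifyingMap_univ_baseChange_restrictScalars 𝓜 ιℚ).symm)) s

end ClassMap

end Literature.AlgebraicGeometry.ModuliOfAbelianVarieties

end
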